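import Summits.KontsevichZagierPeriods.KontsevichZagierPeriods.Theorems.RootDecompZetaThreeFrontierGZLadderFourPolarP07

/-! # `RootDecompZetaThreeFrontierGZLadderFourPolarP08` — part 8/12 of the mechanical ≤400-line split of `l4_src.lean` (sha256 5cc5a9ee4c47da9a…)
Source: decomp-kz lens-1 g13 Layer4_v1.lean @897236f9 minus the RungFour prelude block (imported from …RungFourPreludeP14); --supports stmt-KontsevichZagierPeriods-27141.
Split by census-1 g10 `gen/splitlean.py`: scopes re-opened with their `open`/`variable`/`set_option` context; mathematics and declaration order unchanged. -/

set_option linter.dupNamespace false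
noncomputable section
set_option linter.dupNamespace false
set_option linter.unusedVariables false
set_option linter.unusedSectionVars false
set_option linter.unusedSimpArgs false
open Set MeasureTheory MvPolynomial
open Literature.NumberTheory.Transcendental
open Summit.KontsevichZagierPeriods.KontsevichZagierPeriods.Theorems.RootDecompZetaThreeFrontierWordMoves
namespace Summit.KontsevichZagierPeriods.KontsevichZagierPeriods.Cruxes.GZNormalFormWThree.GZLadder.OrdFour
open Summit.KontsevichZagierPeriods.KontsevichZagierPeriods.Cruxes.GZNormalFormWThree.GZLadder.RungFour
open Summit.KontsevichZagierPeriods.KontsevichZagierPeriods.Cruxes.GZNormalFormWThree.GZLadder.WlogFour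
open Summit.KontsevichZagierPeriods.KontsevichZagierPeriods.Cruxes.GZNormalFormWThree.GZLadder.MatchFour
open Summit.KontsevichZagierPeriods.KontsevichZagierPeriods.Cruxes.GZNormalFormWThree.GZLadder.GapForm

/-- **the nine orders of an integrable reduced datum** (the conjuncts of `IsReducedOrdFour`, verbatim) -/
theorem reduced_orders4 (p : MvPolynomial (Fin 4) ℚ) (β₀ β₁ β₂ γ₁ γ₂ γ₃ α₀₂ α₀₃ α₁₃ : ℕ)
    (hint : IntegrableOn (rf4 p β₀ β₁ β₂ γ₁ γ₂ γ₃ α₀₂ α₀₃ α₁₃) (KZ.openOrderedSimplex 4)) :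
    (∀ e ∈ p.support, β₀ + β₁ + β₂ + α₀₂ + α₀₃ + α₁₃ ≤ e 0 + e 1 + e 2 + e 3 + 3) ∧
    (∀ e ∈ p.support, β₁ + β₂ + α₁₃ ≤ e 1 + e 2 + e 3 + 2) ∧
    (∀ e ∈ p.support, β₂ ≤ e 2 + e 3 + 1) ∧
    (∀ e ∈ (du4P p).support, γ₁ + γ₂ + γ₃ + α₀₂ + α₀₃ + α₁₃ ≤ e 0 + e 1 + e 2 + e 3 + 3) ∧
    (∀ e ∈ (du4P p).support, γ₁ + γ₂ + α₀₂ ≤ e 1 + e 2 + e 3 + 2) ∧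
    (∀ e ∈ (du4P p).support, γ₁ ≤ e 2 + e 3 + 1) ∧
    (∀ e ∈ (s03P p).support, α₀₂ ≤ e 2 + e 3 + 1) ∧
    (∀ e ∈ (s03P p).support, α₀₂ + α₀₃ + α₁₃ ≤ e 1 + e 2 + e 3 + 2) ∧
    (∀ e ∈ (s13P p).support, α₁₃ ≤ e 2 + e 3 + 1) := by
  obtain ⟨h4, h5, h6⟩ := rf4_orders_far p β₀ β₁ β₂ γ₁ γ₂ γ₃ α₀₂ α₀₃ α₁₃ hint
  obtain ⟨h7, h8⟩ := rf4_orders_s03 p β₀ β₁ β₂ γ₁ γ₂ γ₃ α₀₂ α₀₃ α₁₃ hint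
  exact ⟨rf4_order1 _ _ _ _ _ _ _ _ _ _ hint, rf4_order2 _ _ _ _ _ _ _ _ _ _ hint, rf4_order3 _ _ _ _ _ _ _ _ _ _ hint,
    h4, h5, h6, h7, h8, rf4_order_s13 _ _ _ _ _ _ _ _ _ _ hint⟩

/-- **N₄ PROVED**: an integrable reduced datum of dimension 4 satisfies the nine cluster order conditions. -/
theorem ordersFour : OrdersFour := by
  rintro r ⟨hd, p, β₀, β₁, β₂, γ₁, γ₂, γ₃, α₀₂, α₀₃, α₁₃, hi⟩
  have hint : IntegrableOn (rf4 p β₀ β₁ β₂ γ₁ γ₂ γ₃ α₀₂ α₀₃ α₁₃) (KZ.openOrderedSimplex 4) :=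
    (hd ▸ r.integrableOn).congr_fun (fun t ht => hi (by rw [hd]; exact ht)) (measurableSet_simplex 4)
  obtain ⟨h1, h2, h3, h4, h5, h6, h7, h8, h9⟩ := reduced_orders4 p β₀ β₁ β₂ γ₁ γ₂ γ₃ α₀₂ α₀₃ α₁₃ hint
  exact ⟨hd, p, β₀, β₁, β₂, γ₁, γ₂, γ₃, α₀₂, α₀₃, α₁₃, h1, h2, h3, h4, h5, h6, h7, h8, h9, hi⟩

/-- **MATCH₄ ⟸ S₄** (N₄ and E₄ discharged). -/
theorem match_four_of_suff (hS : GapClassIntegrableFour) :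
    ∀ r : KZ.IntegralRep 4, IsReducedFour r → CongInto (layerFour ∪ gzLT 4) (KZ.of r) :=
  match_four_of_orders_suff ordersFour hS

/-- **(A₄) ⟸ S₄ ∧ LAYER₄** — the polar reduction of rung 4 from the ONE remaining analytic stub (gap-class sufficiency on `Δ₄`)
and the layer step. -/
theorem polarReduction_four_of_S_LAYER (hS : GapClassIntegrableFour)
    (h₅ : ∀ s : KZ.IntegralRep 4, IsLayerFour s → CongInto (cellGens 4 ∪ gzLT 4) (KZ.of s)) : PolarReduction 4 :=
  polarReduction_four_of_analysis ordersFour hS h₅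

end Summit.KontsevichZagierPeriods.KontsevichZagierPeriods.Cruxes.GZNormalFormWThree.GZLadder.OrdFour

/-! # §S  S₄ = `GapClassIntegrableFour` PROVED: every ADMISSIBLE gap class is absolutely integrable on `Δ₄` (decomp-kz lens-1 g13)

Port of the LANDED k = 3 convergence engine (`WordMatchPreludeP3–P4`: vertex chart to the cube, max/AM–GM routing of the
far-corner factors onto one-variable powers, Dirichlet/Beta integrability on the cube) ONE DIMENSION UP.  In the cubical chart
`Ψ(y) = (y₃, y₃y₀, y₃y₀y₁, y₃y₀y₁y₂)` (§N2) the three clusters at the vertex `0` become pure powers of `y₃, y₀, y₁` with exponents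
`≥ 0` (conditions (1)–(3) of `Admissible4`), and the six far factors `(1-y₃y₀)^{-γ₁} (1-y₃y₀y₁)^{-γ₂} (1-y₃y₀y₁y₂)^{-γ₃} (1-y₀y₁)^{-α₀₂}
(1-y₀y₁y₂)^{-α₀₃} (1-y₁y₂)^{-α₁₃}` are ROUTED onto `(1-y₃)^{κ₀} (1-y₀)^{κ₁} (1-y₁)^{κ₂} (1-y₂)^{κ₃}` with real weights: a transportation
problem with 6 interval sources on 4 sinks whose Hall conditions are exactly conditions (4)–(9) of `Admissible4`
(`routing4`, solved by a two-stage greedy: the sink `1-y₂` first, then the k = 3 greedy on the other three). -/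

namespace Summit.KontsevichZagierPeriods.KontsevichZagierPeriods.Cruxes.GZNormalFormWThree.GZLadder.SuffFour

open Summit.KontsevichZagierPeriods.KontsevichZagierPeriods.Cruxes.GZNormalFormWThree.GZLadder.RungFour
open Summit.KontsevichZagierPeriods.KontsevichZagierPeriods.Cruxes.GZNormalFormWThree.GZLadder.WlogFour
open Summit.KontsevichZagierPeriods.KontsevichZagierPeriods.Cruxes.GZNormalFormWThree.GZLadder.MatchFour
open Summit.KontsevichZagierPeriods.KontsevichZagierPeriods.Cruxes.GZNormalFormWThree.GZLadder.GapForm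
open Summit.KontsevichZagierPeriods.KontsevichZagierPeriods.Cruxes.GZNormalFormWThree.GZLadder.OrdFour
open Summit.KontsevichZagierPeriods.RootDecompZetaThreeFrontier.WordLayer (one_div_pow_le_rpow2 one_div_pow_le_rpow3
  rpow_mul_rpow_le_max_rpow rpow3_le_max_rpow integrableOn_one_sub_rpow collect2 collect3)

/-! ### §S1 The routing lemma: 6 interval sources on 4 sinks (two-stage greedy) -/

/-- Auxiliary step `exists_min_choice` (§S1): exists min choice. [bookkeeping] -/
theorem exists_min_choice (p q : ℝ) : ∃ X : ℝ, X ≤ p ∧ X ≤ q ∧ (X = p ∨ X = q) :=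
  ⟨min p q, min_le_left _ _, min_le_right _ _, min_choice _ _⟩

set_option maxHeartbeats 6000000 in
/-- **routing₄**: under the six far/diagonal cluster conditions there are non-negative real weights splitting
`γ₁ = b0+b1` (sinks `1-y₃, 1-y₀`), `γ₂ = c0+c1+c2` (`1-y₃,1-y₀,1-y₁`), `γ₃ = g0+g1+g2+g3` (all four), `α₀₂ = d1+d2` (`1-y₀,1-y₁`),
`α₀₃ = e1+e2+e3` (`1-y₀,1-y₁,1-y₂`), `α₁₃ = f2+f3` (`1-y₁,1-y₂`) with every sink load `< κ + 1`. -/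
theorem routing4 (κ0 κ1 κ2 κ3 γ₁ γ₂ γ₃ α₀₂ α₀₃ α₁₃ : ℕ)
    (H01 : γ₁ ≤ κ0 + κ1 + 1) (H12 : α₀₂ ≤ κ1 + κ2 + 1) (H23 : α₁₃ ≤ κ2 + κ3 + 1)
    (H012 : γ₁ + γ₂ + α₀₂ ≤ κ0 + κ1 + κ2 + 2) (H123 : α₀₂ + α₀₃ + α₁₃ ≤ κ1 + κ2 + κ3 + 2)
    (H0123 : γ₁ + γ₂ + γ₃ + α₀₂ + α₀₃ + α₁₃ ≤ κ0 + κ1 + κ2 + κ3 + 3) :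
    ∃ (b0 b1 c0 c1 c2 g0 g1 g2 g3 d1 d2 e1 e2 e3 f2 f3 : ℝ),
      0 ≤ b0 ∧ 0 ≤ b1 ∧ 0 ≤ c0 ∧ 0 ≤ c1 ∧ 0 ≤ c2 ∧ 0 ≤ g0 ∧ 0 ≤ g1 ∧ 0 ≤ g2 ∧ 0 ≤ g3 ∧ 0 ≤ d1 ∧ 0 ≤ d2 ∧
      0 ≤ e1 ∧ 0 ≤ e2 ∧ 0 ≤ e3 ∧ 0 ≤ f2 ∧ 0 ≤ f3 ∧
      b0 + b1 = γ₁ ∧ c0 + c1 + c2 = γ₂ ∧ g0 + g1 + g2 + g3 = γ₃ ∧ d1 + d2 = α₀₂ ∧ e1 + e2 + e3 = α₀₃ ∧ f2 + f3 = α₁₃ ∧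
      b0 + c0 + g0 < κ0 + 1 ∧ b1 + c1 + g1 + d1 + e1 < κ1 + 1 ∧ c2 + g2 + d2 + e2 + f2 < κ2 + 1 ∧
      g3 + e3 + f3 < κ3 + 1 := by
  have H01' : (γ₁ : ℝ) ≤ κ0 + κ1 + 1 := by exact_mod_cast H01
  have H12' : (α₀₂ : ℝ) ≤ κ1 + κ2 + 1 := by exact_mod_cast H12
  have H23' : (α₁₃ : ℝ) ≤ κ2 + κ3 + 1 := by exact_mod_cast H23
  have H012' : (γ₁ : ℝ) + γ₂ + α₀₂ ≤ κ0 + κ1 + κ2 + 2 := by exact_mod_cast H012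
  have H123' : (α₀₂ : ℝ) + α₀₃ + α₁₃ ≤ κ1 + κ2 + κ3 + 2 := by exact_mod_cast H123
  have H0123' : (γ₁ : ℝ) + γ₂ + γ₃ + α₀₂ + α₀₃ + α₁₃ ≤ κ0 + κ1 + κ2 + κ3 + 3 := by exact_mod_cast H0123
  have hk0 : (0 : ℝ) ≤ κ0 := Nat.cast_nonneg _
  have hk1 : (0 : ℝ) ≤ κ1 := Nat.cast_nonneg _
  have hk2 : (0 : ℝ) ≤ κ2 := Nat.cast_nonneg _
  have hk3 : (0 : ℝ) ≤ κ3 := Nat.cast_nonneg _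
  have hb : (0 : ℝ) ≤ γ₁ := Nat.cast_nonneg _
  have hc : (0 : ℝ) ≤ γ₂ := Nat.cast_nonneg _
  have hg : (0 : ℝ) ≤ γ₃ := Nat.cast_nonneg _
  have hd : (0 : ℝ) ≤ α₀₂ := Nat.cast_nonneg _
  have he : (0 : ℝ) ≤ α₀₃ := Nat.cast_nonneg _
  have hf : (0 : ℝ) ≤ α₁₃ := Nat.cast_nonneg _
  -- stage 1: the sink `1-y₂` (capacity `κ3 + 4/5`), filled by `α₁₃`, then `α₀₃`, then `γ₃`
  obtain ⟨F3, hF3a, hF3b, hF3⟩ := exists_min_choice (α₁₃ : ℝ) (κ3 + 4/5)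
  obtain ⟨E3, hE3a, hE3b, hE3⟩ := exists_min_choice (α₀₃ : ℝ) (κ3 + 4/5 - F3)
  obtain ⟨G3, hG3a, hG3b, hG3⟩ := exists_min_choice (γ₃ : ℝ) (κ3 + 4/5 - F3 - E3)
  have hF3n : 0 ≤ F3 := by rcases hF3 with h | h <;> linarith
  have hE3n : 0 ≤ E3 := by rcases hE3 with h | h <;> linarith
  have hG3n : 0 ≤ G3 := by rcases hG3 with h | h <;> linarith
  -- stage 2 data: `B` on the sinks `{1-y₃,1-y₀,1-y₁}`, `D` on `{1-y₀,1-y₁}`, `C2'` the capacity of `1-y₁` left by `α₁₃`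
  obtain ⟨B, hB⟩ : ∃ X : ℝ, X = γ₂ + (γ₃ - G3) := ⟨_, rfl⟩
  obtain ⟨D, hD⟩ : ∃ X : ℝ, X = α₀₂ + (α₀₃ - E3) := ⟨_, rfl⟩
  obtain ⟨C2', hC2'⟩ : ∃ X : ℝ, X = κ2 + 4/5 - (α₁₃ - F3) := ⟨_, rfl⟩
  have hBn : 0 ≤ B := by linarith
  have hDn : 0 ≤ D := by linarith
  have hC2'n : 0 ≤ C2' := by rcases hF3 with h | h <;> linarith
  have Hall01 : (γ₁ : ℝ) ≤ (κ0 + 4/5) + (κ1 + 4/5) := by linarith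
  have Hall12 : D ≤ (κ1 + 4/5) + C2' := by
    rcases hF3 with h | h <;> rcases hE3 with h' | h' <;>
      linarith only [h, h', hD, hC2', H12', H123', hE3a, hE3b, hF3a, hF3b, hE3n, hF3n, hd, he, hf, hk1, hk2, hk3]
  have Hall02 : (γ₁ : ℝ) + B + D ≤ (κ0 + 4/5) + (κ1 + 4/5) + C2' := by
    rcases hF3 with h | h <;> rcases hE3 with h' | h' <;> rcases hG3 with h'' | h'' <;>
      linarith only [h, h', h'', hB, hD, hC2', H012', H0123', hF3a, hF3b, hE3a, hE3b, hG3a, hG3b, hF3n, hE3n, hG3n,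
        hb, hc, hg, hd, he, hf, hk0, hk1, hk2, hk3]
  -- stage 2: the greedy on three sinks
  obtain ⟨A, hAa, hAb, hA⟩ := exists_min_choice D C2'
  obtain ⟨b0, hb0a, hb0b, hb0⟩ := exists_min_choice (γ₁ : ℝ) (κ0 + 4/5)
  obtain ⟨P0, hP0a, hP0b, hP0⟩ := exists_min_choice B (κ0 + 4/5 - b0)
  obtain ⟨P2, hP2a, hP2b, hP2⟩ := exists_min_choice (B - P0) (C2' - A)
  have hAn : 0 ≤ A := by rcases hA with h | h <;> linarith
  have hb0n : 0 ≤ b0 := by rcases hb0 with h | h <;> linarith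
  have hP0n : 0 ≤ P0 := by rcases hP0 with h | h <;> linarith
  have hP2n : 0 ≤ P2 := by rcases hP2 with h | h <;> linarith
  have main : ((γ₁ : ℝ) - b0) + (D - A) + (B - P0 - P2) ≤ κ1 + 4/5 := by
    rcases hA with h₁ | h₁ <;> rcases hb0 with h₂ | h₂ <;> rcases hP0 with h₃ | h₃ <;> rcases hP2 with h₄ | h₄ <;>
      linarith only [h₁, h₂, h₃, h₄, hAa, hAb, hb0a, hb0b, hP0a, hP0b, hP2a, hP2b, Hall01, Hall12, Hall02, hBn, hDn,
        hC2'n, hAn, hb0n, hP0n, hP2n, hb, hk0, hk1]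
  -- splitting the shared pieces: `B = γ₂ + (γ₃ - G3)` into `P0 | B - P0 - P2 | P2`, `D = α₀₂ + (α₀₃ - E3)` into `D - A | A`
  obtain ⟨c0, hc0a, hc0b, hc0⟩ := exists_min_choice (γ₂ : ℝ) P0
  obtain ⟨c1, hc1a, hc1b, hc1⟩ := exists_min_choice ((γ₂ : ℝ) - c0) (B - P0 - P2)
  obtain ⟨d2, hd2a, hd2b, hd2⟩ := exists_min_choice (α₀₂ : ℝ) A
  have hc0n : 0 ≤ c0 := by rcases hc0 with h | h <;> linarith
  have hc1n : 0 ≤ c1 := by rcases hc1 with h | h <;> linarith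
  have hd2n : 0 ≤ d2 := by rcases hd2 with h | h <;> linarith
  have hg2n : 0 ≤ P2 - ((γ₂ : ℝ) - c0 - c1) := by
    rcases hc1 with h | h
    · linarith
    · rcases hc0 with h' | h' <;> linarith
  have he1n : 0 ≤ (D - A) - ((α₀₂ : ℝ) - d2) := by rcases hd2 with h | h <;> linarith
  refine ⟨b0, γ₁ - b0, c0, c1, γ₂ - c0 - c1, P0 - c0, (B - P0 - P2) - c1, P2 - (γ₂ - c0 - c1), G3,
    α₀₂ - d2, d2, (D - A) - (α₀₂ - d2), A - d2, E3, α₁₃ - F3, F3,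
    hb0n, by linarith, hc0n, hc1n, by linarith, by linarith, by linarith, hg2n, hG3n, by linarith, hd2n,
    he1n, by linarith, hE3n, by linarith, hF3n, by ring, by ring, by linarith, by ring, by linarith, by ring,
    by linarith, by linarith, by linarith, by linarith⟩

/-! ### §S2 One-variable powers on the cube `(0,1)⁴`; the fourfold max/AM–GM bound -/

/-- Auxiliary step `Cube4_eq_pi` (§S2): Cube4 eq pi. [bookkeeping] -/
theorem Cube4_eq_pi : Cube4 = Set.univ.pi (fun _ : Fin 4 => Ioo (0:ℝ) 1) := by
  ext y
  simp only [Cube4, mem_setOf_eq, mem_univ_pi, mem_Ioo]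
  refine ⟨fun h i => ?_, fun h => ⟨(h 0).1, (h 0).2, (h 1).1, (h 1).2, (h 2).1, (h 2).2, (h 3).1, (h 3).2⟩⟩
  obtain ⟨h0, h01, h1, h11, h2, h21, h3, h31⟩ := h
  fin_cases i
  · exact ⟨h0, h01⟩
  · exact ⟨h1, h11⟩
  · exact ⟨h2, h21⟩
  · exact ⟨h3, h31⟩

/-- a product of one-variable powers `∏ (1-yᵢ)^{aᵢ}`, all `aᵢ > -1`, is integrable on the cube -/
theorem integrableOn_cube4_rpow (a : Fin 4 → ℝ) (ha : ∀ i, -1 < a i) :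
    IntegrableOn (fun y : Fin 4 → ℝ => ∏ i, (1 - y i) ^ a i) Cube4 := by
  rw [IntegrableOn, Cube4_eq_pi, volume_pi, Measure.restrict_pi_pi]
  exact Integrable.fintype_prod (f := fun i x => (1 - x) ^ a i) (fun i => integrableOn_one_sub_rpow (ha i))

/-- domination on the cube by a product of one-variable powers gives integrability -/
theorem integrableOn_cube4_of_le {G : (Fin 4 → ℝ) → ℝ} (hG : ContinuousOn G Cube4) (a : Fin 4 → ℝ) (ha : ∀ i, -1 < a i)
    (hle : ∀ y ∈ Cube4, |G y| ≤ ∏ i, (1 - y i) ^ a i) : IntegrableOn G Cube4 := by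
  refine Integrable.mono' (integrableOn_cube4_rpow a ha) (hG.aestronglyMeasurable measurableSet_Cube4) ?_
  rw [ae_restrict_iff' measurableSet_Cube4]
  exact Filter.Eventually.of_forall fun y hy => by rw [Real.norm_eq_abs]; exact hle y hy

/-- Auxiliary step `prod_four_rpow` (§S2): prod four rpow. [bookkeeping] -/
theorem prod_four_rpow (y : Fin 4 → ℝ) (a : Fin 4 → ℝ) :
    ∏ i, (1 - y i) ^ a i = (1 - y 0) ^ a 0 * (1 - y 1) ^ a 1 * (1 - y 2) ^ a 2 * (1 - y 3) ^ a 3 := by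
  rw [Fin.prod_univ_four]

/-- Auxiliary step `prod4_le_each` (§S2): prod4 le each. [bookkeeping] -/
theorem prod4_le_each {u v w x : ℝ} (hu0 : 0 ≤ u) (hu1 : u ≤ 1) (hv0 : 0 ≤ v) (hv1 : v ≤ 1) (hw0 : 0 ≤ w) (hw1 : w ≤ 1)
    (hx0 : 0 ≤ x) (hx1 : x ≤ 1) :
    u * v * w * x ≤ u ∧ u * v * w * x ≤ v ∧ u * v * w * x ≤ w ∧ u * v * w * x ≤ x := by
  have hvw : v * w ≤ 1 := mul_le_one₀ hv1 hw0 hw1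
  have hvwx : v * w * x ≤ 1 := mul_le_one₀ hvw hx0 hx1
  have huw : u * w ≤ 1 := mul_le_one₀ hu1 hw0 hw1
  have huwx : u * w * x ≤ 1 := mul_le_one₀ huw hx0 hx1
  have huv : u * v ≤ 1 := mul_le_one₀ hu1 hv0 hv1
  have huvx : u * v * x ≤ 1 := mul_le_one₀ huv hx0 hx1
  have huvw : u * v * w ≤ 1 := mul_le_one₀ huv hw0 hw1
  refine ⟨?_, ?_, ?_, ?_⟩
  · calc u * v * w * x = u * (v * w * x) := by ring
      _ ≤ u * 1 := mul_le_mul_of_nonneg_left hvwx hu0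
      _ = u := mul_one u
  · calc u * v * w * x = v * (u * w * x) := by ring
      _ ≤ v * 1 := mul_le_mul_of_nonneg_left huwx hv0
      _ = v := mul_one v
  · calc u * v * w * x = w * (u * v * x) := by ring
      _ ≤ w * 1 := mul_le_mul_of_nonneg_left huvx hw0
      _ = w := mul_one w
  · calc u * v * w * x = x * (u * v * w) := by ring
      _ ≤ x * 1 := mul_le_mul_of_nonneg_left huvw hx0
      _ = x := mul_one x

/-- Auxiliary step `rpow4_le_max_rpow` (§S2): rpow4 le max rpow. [bookkeeping] -/
theorem rpow4_le_max_rpow {x y z w a b c d : ℝ} (hx : 0 ≤ x) (hy : 0 ≤ y) (hz : 0 ≤ z) (hw : 0 ≤ w) (ha : 0 ≤ a)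
    (hb : 0 ≤ b) (hc : 0 ≤ c) (hd : 0 ≤ d) :
    x ^ a * y ^ b * z ^ c * w ^ d ≤ (max (max (max x y) z) w) ^ (a + b + c + d) := by
  set m := max (max (max x y) z) w with hm_def
  have hxm : x ≤ m := ((le_max_left _ _).trans (le_max_left _ _)).trans (le_max_left _ _)
  have hym : y ≤ m := ((le_max_right _ _).trans (le_max_left _ _)).trans (le_max_left _ _)
  have hzm : z ≤ m := (le_max_right _ _).trans (le_max_left _ _)
  have hwm : w ≤ m := le_max_right _ _
  have hm : 0 ≤ m := hx.trans hxm
  have e1 : x ^ a ≤ m ^ a := Real.rpow_le_rpow hx hxm ha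
  have e2 : y ^ b ≤ m ^ b := Real.rpow_le_rpow hy hym hb
  have e3 : z ^ c ≤ m ^ c := Real.rpow_le_rpow hz hzm hc
  have e4 : w ^ d ≤ m ^ d := Real.rpow_le_rpow hw hwm hd
  calc x ^ a * y ^ b * z ^ c * w ^ d ≤ m ^ a * m ^ b * m ^ c * m ^ d :=
        mul_le_mul (mul_le_mul (mul_le_mul e1 e2 (Real.rpow_nonneg hy _) (Real.rpow_nonneg hm _)) e3
          (Real.rpow_nonneg hz _) (mul_nonneg (Real.rpow_nonneg hm _) (Real.rpow_nonneg hm _))) e4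
          (Real.rpow_nonneg hw _) (mul_nonneg (mul_nonneg (Real.rpow_nonneg hm _) (Real.rpow_nonneg hm _))
            (Real.rpow_nonneg hm _))
    _ = m ^ (a + b + c + d) := by
        rw [← Real.rpow_add_of_nonneg hm ha hb, ← Real.rpow_add_of_nonneg hm (add_nonneg ha hb) hc,
          ← Real.rpow_add_of_nonneg hm (add_nonneg (add_nonneg ha hb) hc) hd]

/-- `1/(1-uvwx)^n ≤ (1-u)^{-a}(1-v)^{-b}(1-w)^{-c}(1-x)^{-d}` for `u, v, w, x ∈ [0,1)`, `a, b, c, d ≥ 0`, `a+b+c+d = n` -/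
theorem one_div_pow_le_rpow4 {u v w x a b c d : ℝ} {n : ℕ} (hu0 : 0 ≤ u) (hu1 : u < 1) (hv0 : 0 ≤ v) (hv1 : v < 1)
    (hw0 : 0 ≤ w) (hw1 : w < 1) (hx0 : 0 ≤ x) (hx1 : x < 1) (ha : 0 ≤ a) (hb : 0 ≤ b) (hc : 0 ≤ c) (hd : 0 ≤ d)
    (habcd : a + b + c + d = n) :
    1 / (1 - u * v * w * x) ^ n ≤ (1 - u) ^ (-a) * (1 - v) ^ (-b) * (1 - w) ^ (-c) * (1 - x) ^ (-d) := by
  have hu' : 0 < 1 - u := by linarith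
  have hv' : 0 < 1 - v := by linarith
  have hw' : 0 < 1 - w := by linarith
  have hx' : 0 < 1 - x := by linarith
  obtain ⟨q1, q2, q3, q4⟩ := prod4_le_each hu0 hu1.le hv0 hv1.le hw0 hw1.le hx0 hx1.le
  have hm0 : 0 ≤ max (max (max (1 - u) (1 - v)) (1 - w)) (1 - x) := hx'.le.trans (le_max_right _ _)
  have hmax : max (max (max (1 - u) (1 - v)) (1 - w)) (1 - x) ≤ 1 - u * v * w * x :=
    max_le (max_le (max_le (by linarith) (by linarith)) (by linarith)) (by linarith)
  have hprod : (1 - u) ^ a * (1 - v) ^ b * (1 - w) ^ c * (1 - x) ^ d ≤ (1 - u * v * w * x) ^ n :=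
    calc (1 - u) ^ a * (1 - v) ^ b * (1 - w) ^ c * (1 - x) ^ d
          ≤ (max (max (max (1 - u) (1 - v)) (1 - w)) (1 - x)) ^ (a + b + c + d) :=
          rpow4_le_max_rpow hu'.le hv'.le hw'.le hx'.le ha hb hc hd
      _ = (max (max (max (1 - u) (1 - v)) (1 - w)) (1 - x)) ^ n := by rw [habcd, Real.rpow_natCast]
      _ ≤ (1 - u * v * w * x) ^ n := pow_le_pow_left₀ hm0 hmax n
  have hpos : 0 < (1 - u) ^ a * (1 - v) ^ b * (1 - w) ^ c * (1 - x) ^ d :=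
    mul_pos (mul_pos (mul_pos (Real.rpow_pos_of_pos hu' _) (Real.rpow_pos_of_pos hv' _)) (Real.rpow_pos_of_pos hw' _))
      (Real.rpow_pos_of_pos hx' _)
  rw [Real.rpow_neg hu'.le, Real.rpow_neg hv'.le, Real.rpow_neg hw'.le, Real.rpow_neg hx'.le, ← mul_inv, ← mul_inv,
    ← mul_inv, ← one_div]
  exact one_div_le_one_div_of_le hpos hprod

/-- Auxiliary step `collect5` (§S2): collect5. [bookkeeping] -/
theorem collect5 {x : ℝ} (hx : 0 < x) (n : ℕ) (p q r s u : ℝ) :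
    x ^ n * x ^ (-p) * x ^ (-q) * x ^ (-r) * x ^ (-s) * x ^ (-u) = x ^ ((n : ℝ) - p - q - r - s - u) := by
  rw [sub_eq_add_neg, sub_eq_add_neg, sub_eq_add_neg, sub_eq_add_neg, sub_eq_add_neg, ← Real.rpow_natCast,
    ← Real.rpow_add hx, ← Real.rpow_add hx, ← Real.rpow_add hx, ← Real.rpow_add hx, ← Real.rpow_add hx]

/-! ### §S3 Gap classes in the cubical chart -/

/-- **the vertex blow-up push-forward**: `y ↦ y₃³y₀²y₁·F(Ψ y)` integrable on the cube ⟹ `F` integrable on `Δ₄` -/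
theorem integrableOn_of_cchart {F : (Fin 4 → ℝ) → ℝ} (hF : IntegrableOn (fun y => y 3 ^ 3 * y 0 ^ 2 * y 1 * F (cΨ y)) Cube4) :
    IntegrableOn F (KZ.openOrderedSimplex 4) := by
  rw [← image_cΨ]
  refine (integrableOn_image_iff_integrableOn_abs_det_fderiv_smul (μ := volume) measurableSet_Cube4
    (fun y _ => (hasFDerivAt_cΨ y).hasFDerivWithinAt) injOn_cΨ F).2 ?_
  refine hF.congr_fun (fun y hy => ?_) measurableSet_Cube4
  have hy0 := hy.1
  have hy1 := hy.2.2.1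
  have hy3 := hy.2.2.2.2.2.2.1
  show y 3 ^ 3 * y 0 ^ 2 * y 1 * F (cΨ y) = |(cD y).det| • F (cΨ y)
  rw [det_cD, abs_neg, abs_of_pos (by positivity), smul_eq_mul]

/-- Auxiliary step `cube4_facts` (§S3): cube4 facts. [bookkeeping] -/
theorem cube4_facts {y : Fin 4 → ℝ} (hy : y ∈ Cube4) :
    0 < 1 - y 0 ∧ 0 < 1 - y 1 ∧ 0 < 1 - y 2 ∧ 0 < 1 - y 3 ∧ 0 < 1 - y 3 * y 0 ∧ 0 < 1 - y 3 * y 0 * y 1 ∧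
      0 < 1 - y 3 * y 0 * y 1 * y 2 ∧ 0 < 1 - y 0 * y 1 ∧ 0 < 1 - y 0 * y 1 * y 2 ∧ 0 < 1 - y 1 * y 2 := by
  obtain ⟨h0, h01, h1, h11, h2, h21, h3, h31⟩ := hy
  have a : y 3 * y 0 < 1 := mul_lt_one_of_nonneg_of_lt_one_left h3.le h31 h01.le
  have b : y 3 * y 0 * y 1 < 1 := mul_lt_one_of_nonneg_of_lt_one_left (mul_pos h3 h0).le a h11.le
  have c : y 3 * y 0 * y 1 * y 2 < 1 := mul_lt_one_of_nonneg_of_lt_one_left (mul_pos (mul_pos h3 h0) h1).le b h21.le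
  have d : y 0 * y 1 < 1 := mul_lt_one_of_nonneg_of_lt_one_left h0.le h01 h11.le
  have e : y 0 * y 1 * y 2 < 1 := mul_lt_one_of_nonneg_of_lt_one_left (mul_pos h0 h1).le d h21.le
  have f : y 1 * y 2 < 1 := mul_lt_one_of_nonneg_of_lt_one_left h1.le h11 h21.le
  exact ⟨by linarith, by linarith, by linarith, by linarith, by linarith, by linarith, by linarith, by linarith,
    by linarith, by linarith⟩

/-- the far-corner part of a gap class in the cubical chart -/
def gapW4 (κ : Fin 5 →₀ ℕ) (γ₁ γ₂ γ₃ α₀₂ α₀₃ α₁₃ : ℕ) (y : Fin 4 → ℝ) : ℝ :=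
  y 2 ^ κ 4 * ((1 - y 3) ^ κ 0 * (1 - y 0) ^ κ 1 * (1 - y 1) ^ κ 2 * (1 - y 2) ^ κ 3) /
    ((1 - y 3 * y 0) ^ γ₁ * (1 - y 3 * y 0 * y 1) ^ γ₂ * (1 - y 3 * y 0 * y 1 * y 2) ^ γ₃ * (1 - y 0 * y 1) ^ α₀₂ *
      (1 - y 0 * y 1 * y 2) ^ α₀₃ * (1 - y 1 * y 2) ^ α₁₃)

/-- the chart identity, cleared of the three vertex-cluster powers:
`y₃^{B₃} y₀^{B₀} y₁^{β₂} · (y₃³y₀²y₁ · gapF4(Ψ y)) = y₃^{κ₁+κ₂+κ₃+κ₄+3} y₀^{κ₂+κ₃+κ₄+2} y₁^{κ₃+κ₄+1} · gapW4(y)` -/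
theorem gapF4_chart_mul (κ : Fin 5 →₀ ℕ) (β₀ β₁ β₂ γ₁ γ₂ γ₃ α₀₂ α₀₃ α₁₃ : ℕ) {y : Fin 4 → ℝ} (hy : y ∈ Cube4) :
    y 3 ^ (β₀ + β₁ + β₂ + α₀₂ + α₀₃ + α₁₃) * y 0 ^ (β₁ + β₂ + α₁₃) * y 1 ^ β₂ *
        (y 3 ^ 3 * y 0 ^ 2 * y 1 * gapF4 κ β₀ β₁ β₂ γ₁ γ₂ γ₃ α₀₂ α₀₃ α₁₃ (cΨ y)) =
      y 3 ^ (κ 1 + κ 2 + κ 3 + κ 4 + 3) * y 0 ^ (κ 2 + κ 3 + κ 4 + 2) * y 1 ^ (κ 3 + κ 4 + 1) *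
        gapW4 κ γ₁ γ₂ γ₃ α₀₂ α₀₃ α₁₃ y := by
  obtain ⟨h0, h01, h1, h11, h2, h21, h3, h31⟩ := hy
  obtain ⟨u0, u1, u2, u3, p30, p301, p3012, p01, p012, p12⟩ := cube4_facts ⟨h0, h01, h1, h11, h2, h21, h3, h31⟩
  have hy0 : y 0 ≠ 0 := h0.ne'
  have hy1 : y 1 ≠ 0 := h1.ne'
  have hy2 : y 2 ≠ 0 := h2.ne'
  have hy3 : y 3 ≠ 0 := h3.ne'
  rw [gapF4, gapW4, cΨ_zero, cΨ_one, cΨ_two, cΨ_three]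
  have f1 : y 3 - y 3 * y 0 = y 3 * (1 - y 0) := by ring
  have f2 : y 3 * y 0 - y 3 * y 0 * y 1 = y 3 * y 0 * (1 - y 1) := by ring
  have f3 : y 3 * y 0 * y 1 - y 3 * y 0 * y 1 * y 2 = y 3 * y 0 * y 1 * (1 - y 2) := by ring
  have f4 : y 3 - y 3 * y 0 * y 1 = y 3 * (1 - y 0 * y 1) := by ring
  have f5 : y 3 - y 3 * y 0 * y 1 * y 2 = y 3 * (1 - y 0 * y 1 * y 2) := by ring
  have f6 : y 3 * y 0 - y 3 * y 0 * y 1 * y 2 = y 3 * y 0 * (1 - y 1 * y 2) := by ring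
  rw [f1, f2, f3, f4, f5, f6]
  simp only [mul_pow, mul_div_assoc']
  rw [div_eq_div_iff (by positivity) (by positivity)]
  ring

/-- Auxiliary step `gapW4_nonneg` (§S3): gap W4 nonneg. [bookkeeping] -/
theorem gapW4_nonneg (κ : Fin 5 →₀ ℕ) (γ₁ γ₂ γ₃ α₀₂ α₀₃ α₁₃ : ℕ) {y : Fin 4 → ℝ} (hy : y ∈ Cube4) :
    0 ≤ gapW4 κ γ₁ γ₂ γ₃ α₀₂ α₀₃ α₁₃ y := by
  obtain ⟨u0, u1, u2, u3, p30, p301, p3012, p01, p012, p12⟩ := cube4_facts hy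
  have h2 := hy.2.2.2.2.1
  unfold gapW4
  positivity

/-- in the chart an admissible (conditions (1)–(3)) gap class is dominated by its far-corner part -/
theorem gapF4_chart_le (κ : Fin 5 →₀ ℕ) {β₀ β₁ β₂ γ₁ γ₂ γ₃ α₀₂ α₀₃ α₁₃ : ℕ}
    (hV1 : β₀ + β₁ + β₂ + α₀₂ + α₀₃ + α₁₃ ≤ κ 1 + κ 2 + κ 3 + κ 4 + 3) (hV2 : β₁ + β₂ + α₁₃ ≤ κ 2 + κ 3 + κ 4 + 2)
    (hV3 : β₂ ≤ κ 3 + κ 4 + 1) {y : Fin 4 → ℝ} (hy : y ∈ Cube4) :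
    y 3 ^ 3 * y 0 ^ 2 * y 1 * gapF4 κ β₀ β₁ β₂ γ₁ γ₂ γ₃ α₀₂ α₀₃ α₁₃ (cΨ y) ≤ gapW4 κ γ₁ γ₂ γ₃ α₀₂ α₀₃ α₁₃ y := by
  obtain ⟨h0, h01, h1, h11, h2, h21, h3, h31⟩ := hy
  have hW := gapW4_nonneg κ γ₁ γ₂ γ₃ α₀₂ α₀₃ α₁₃ ⟨h0, h01, h1, h11, h2, h21, h3, h31⟩
  have hP : 0 < y 3 ^ (β₀ + β₁ + β₂ + α₀₂ + α₀₃ + α₁₃) * y 0 ^ (β₁ + β₂ + α₁₃) * y 1 ^ β₂ := by positivity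
  have key := gapF4_chart_mul κ β₀ β₁ β₂ γ₁ γ₂ γ₃ α₀₂ α₀₃ α₁₃ ⟨h0, h01, h1, h11, h2, h21, h3, h31⟩
  refine le_of_mul_le_mul_left ?_ hP
  rw [key]
  exact mul_le_mul_of_nonneg_right (mul_le_mul (mul_le_mul (pow_le_pow_of_le_one h3.le h31.le hV1)
    (pow_le_pow_of_le_one h0.le h01.le hV2) (by positivity) (by positivity))
    (pow_le_pow_of_le_one h1.le h11.le hV3) (by positivity) (by positivity)) hW

end Summit.KontsevichZagierPeriods.KontsevichZagierPeriods.Cruxes.GZNormalFormWThree.GZLadder.SuffFour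
end
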